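import Literature.NumberTheory.LFunctions.WeilTwoPrimeOddMarginGBase
import Literature.NumberTheory.LFunctions.WeilTwoPrimeOddMarginGDataP7
import Literature.NumberTheory.LFunctions.WeilBlockRowsP
import HarnessLib

/-!
# Two-prime odd-margin certificate G: the materialized block agrees with `P_r`, rows 0–14

`WeilCert.checkPmRow` (row `k` of the claim `Pm_{kl} = P_r(2k+1, 2l+1)`) for rows 0–14 of certificate G, by `decide +kernel`. Pure proof file; nothing is asserted.
-/

noncomputable section

namespace Literature.NumberTheory.LFunctions

set_option maxHeartbeats 0 in
/-- Row 0 of the materialized block is row 0 of `P_r` (certificate G). [folklore] -/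
theorem checkPmRow1_0_weilCert23G : weilCert23GBase.checkPmRow weilCert23GNu weilCert23GPm 1 0 = true := by
  decide +kernel

set_option maxHeartbeats 0 in
/-- Row 1 of the materialized block is row 1 of `P_r` (certificate G). [folklore] -/
theorem checkPmRow1_1_weilCert23G : weilCert23GBase.checkPmRow weilCert23GNu weilCert23GPm 1 1 = true := by
  decide +kernel

set_option maxHeartbeats 0 in
/-- Row 2 of the materialized block is row 2 of `P_r` (certificate G). [folklore] -/
theorem checkPmRow1_2_weilCert23G : weilCert23GBase.checkPmRow weilCert23GNu weilCert23GPm 1 2 = true := by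
  decide +kernel

set_option maxHeartbeats 0 in
/-- Row 3 of the materialized block is row 3 of `P_r` (certificate G). [folklore] -/
theorem checkPmRow1_3_weilCert23G : weilCert23GBase.checkPmRow weilCert23GNu weilCert23GPm 1 3 = true := by
  decide +kernel

set_option maxHeartbeats 0 in
/-- Row 4 of the materialized block is row 4 of `P_r` (certificate G). [folklore] -/
theorem checkPmRow1_4_weilCert23G : weilCert23GBase.checkPmRow weilCert23GNu weilCert23GPm 1 4 = true := by
  decide +kernel

set_option maxHeartbeats 0 in
/-- Row 5 of the materialized block is row 5 of `P_r` (certificate G). [folklore] -/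
theorem checkPmRow1_5_weilCert23G : weilCert23GBase.checkPmRow weilCert23GNu weilCert23GPm 1 5 = true := by
  decide +kernel

set_option maxHeartbeats 0 in
/-- Row 6 of the materialized block is row 6 of `P_r` (certificate G). [folklore] -/
theorem checkPmRow1_6_weilCert23G : weilCert23GBase.checkPmRow weilCert23GNu weilCert23GPm 1 6 = true := by
  decide +kernel

set_option maxHeartbeats 0 in
/-- Row 7 of the materialized block is row 7 of `P_r` (certificate G). [folklore] -/
theorem checkPmRow1_7_weilCert23G : weilCert23GBase.checkPmRow weilCert23GNu weilCert23GPm 1 7 = true := by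
  decide +kernel

set_option maxHeartbeats 0 in
/-- Row 8 of the materialized block is row 8 of `P_r` (certificate G). [folklore] -/
theorem checkPmRow1_8_weilCert23G : weilCert23GBase.checkPmRow weilCert23GNu weilCert23GPm 1 8 = true := by
  decide +kernel

set_option maxHeartbeats 0 in
/-- Row 9 of the materialized block is row 9 of `P_r` (certificate G). [folklore] -/
theorem checkPmRow1_9_weilCert23G : weilCert23GBase.checkPmRow weilCert23GNu weilCert23GPm 1 9 = true := by
  decide +kernel

set_option maxHeartbeats 0 in
/-- Row 10 of the materialized block is row 10 of `P_r` (certificate G). [folklore] -/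
theorem checkPmRow1_10_weilCert23G : weilCert23GBase.checkPmRow weilCert23GNu weilCert23GPm 1 10 = true := by
  decide +kernel

set_option maxHeartbeats 0 in
/-- Row 11 of the materialized block is row 11 of `P_r` (certificate G). [folklore] -/
theorem checkPmRow1_11_weilCert23G : weilCert23GBase.checkPmRow weilCert23GNu weilCert23GPm 1 11 = true := by
  decide +kernel

set_option maxHeartbeats 0 in
/-- Row 12 of the materialized block is row 12 of `P_r` (certificate G). [folklore] -/
theorem checkPmRow1_12_weilCert23G : weilCert23GBase.checkPmRow weilCert23GNu weilCert23GPm 1 12 = true := by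
  decide +kernel

set_option maxHeartbeats 0 in
/-- Row 13 of the materialized block is row 13 of `P_r` (certificate G). [folklore] -/
theorem checkPmRow1_13_weilCert23G : weilCert23GBase.checkPmRow weilCert23GNu weilCert23GPm 1 13 = true := by
  decide +kernel

set_option maxHeartbeats 0 in
/-- Row 14 of the materialized block is row 14 of `P_r` (certificate G). [folklore] -/
theorem checkPmRow1_14_weilCert23G : weilCert23GBase.checkPmRow weilCert23GNu weilCert23GPm 1 14 = true := by
  decide +kernel

end Literature.NumberTheory.LFunctions
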